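/-
Copyright: the b2b-balaban T⁴-continuum CRUX team, leaf lineage `t4-ne7b-formalise-leaf-04` (gen 162). Project licence.
-/
import Summits.QuantumFields.BalabanUV.T4Continuum.Spine.NE7b.LocalNemytskiiSupBall
import Summits.QuantumFields.BalabanUV.T4Continuum.Spine.NE7b.SupInteractingChart

/-!
# THE FLUCTUATION COVARIANCE AT THE BACKGROUND FROM LETTERS ON THE SUP BALL: `C(w) = A(w)⁻¹ ∘ inr` for the interacting chart
# `A(w) h = (Q h, R h + P(N′(σ w) h))` of `…LocalNemytskiiSupBall` §4, its fibre equation, the bound `‖C(w)‖ ≤ (N⁻¹ − c)⁻¹` and the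
# background-dependence modulus `‖C(w)κ − C(w′)κ‖ ≤ (N⁻¹ − c)⁻³·(C_P·L(ρ))·‖w − w′‖·‖κ‖` — the local-letters twin of the OWNER's
# (61) v1.1 §8 `…SupInteractingChart.exists_fluctuation_covariance_at_background`
# (row NE7b, node U5c; LNSB §4 + (61) §8's abstract chart letters BY NAME; [folklore])

Cell `pub-balaban`, sub-cell `t4`, spine estimate NE7b (`T4WeightBudget.RelWeightBound`; the cell's OWN estimate — NOT PRINTED
in [Bałaban 1983–89], NOT PROVED).  Crux-route work under `Spine/NE7b/` by leaf lineage `t4-ne7b-formalise-leaf-04` (gen 162) under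
FREEZE (0)'s crux-prover clause (the OWNER's word W-ne7bp1-g114-11 (b): «LNSB §6, the local twin of (61) v1.1 §8 — GO, WANTED»; a
SIBLING rather than an append because `…LocalNemytskiiSupBall` sits at 344 of 400 lines — the same reason (61) is a sibling of (58)).
NOTHING of Bałaban's is named as a Lean object, valued or asserted; no `T4Continuum/Support` leaf typed; no `def`, no notation; zero
`sorry`.  Imports (BY NAME): this lineage's `…LocalNemytskiiSupBall` (LNSB: `exists_smallField_branch_ball`) and the OWNER's (61)
`…SupInteractingChart` (§8's currency-free chart letters `fibre_letters`, `norm_symm_inr_le`, `norm_symm_inr_sub_le`).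

WHY (located).  (61) §8 reads the fluctuation covariance of the linearised interacting action at the background off the interacting
chart, with the Nemytskii modulus `‖N′φ − N′ψ‖ ≤ L‖φ − ψ‖` taken from GLOBAL letters of `u′`.  With letters on `|t| ≤ ρ` only (LNSB),
the modulus holds for `φ, ψ` in the closed sup ball of radius `ρ` — which is where the backgrounds `σ w`, `σ w′` live (`‖σ w‖ ≤ r < ρ`);
everything else in (61) §8 is currency-free chart algebra, imported by name.

WHAT IS PROVED ([folklore]; `ℓ^∞ := lp (fun _ : ι => ℝ) ∞`):
* §1 `norm_nemytskiiDeriv_sub_le_of_mem` — the Nemytskii derivative family's MODULUS ON THE BALL from its displayed action there: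
  `N′φ h i = u′(φ i)·h i` for `‖φ‖ ≤ ρ` and `Lip u′ ≤ L` on `[−ρ, ρ]` give `‖N′φ − N′ψ‖ ≤ L‖φ − ψ‖` for `‖φ‖, ‖ψ‖ ≤ ρ`.
* §2 **`exists_fluctuation_covariance_at_background_ball`** — LNSB §4's hypotheses (`ι` nonempty; chart `T = (Q, R)` with
  `‖T⁻¹‖ ≤ N`; `‖P‖ ≤ C_P`; `u` differentiable everywhere, `u 0 = 0`, `|u′| ≤ λ` and `Lip u′ ≤ L` on `|t| ≤ ρ`; `C_P·λ ≤ c < N⁻¹`;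
  `0 ≤ r < ρ`) ⟹ `∃ N N′ σ C`: `N φ i = u(φ i)`; `N′`'s action and `‖N′φ‖ ≤ λ` on the closed `ρ`-ball, `HasFDerivAt N (N′φ) φ` on the
  open one, the modulus on the closed one; `σ 0 = 0` and LNSB §4's branch letters (existence on `‖w‖ ≤ (N⁻¹ − c)r`, `Q(σ w) = w`,
  `R(σ w) + P(N(σ w)) = 0`, Lipschitz, uniqueness); and at every interior `‖w‖ < (N⁻¹ − c)r`: `Q(C(w)κ) = 0`,
  `R(C(w)κ) + P(N′(σ w)(C(w)κ)) = κ`, uniqueness of that fibre solution, **`‖C(w)κ‖ ≤ (N⁻¹ − c)⁻¹‖κ‖`**, `‖C(w)‖ ≤ (N⁻¹ − c)⁻¹`, the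
  interacting chart `A(w)` with `‖A(w)⁻¹‖ ≤ (N⁻¹ − c)⁻¹`, `Dσ(w) = A(w)⁻¹∘inl`, `C(w) = A(w)⁻¹∘inr`; and on the interior ball
  **`‖C(w)κ − C(w′)κ‖ ≤ (N⁻¹ − c)⁻³·(C_P·L)·‖w − w′‖·‖κ‖`**.
* §3 toy.

NOT HERE (honest): the Gaussian-skeleton instance (ASE's `T`); values of `λ(ρ)`, `L(ρ)`; base points other than `0`; anything of
Bałaban's ((A3), NC-NE7b-α UNRULED).  BY-NAME EFFECT ON THE WALL: NONE.  NE7b NOT PRINTED ∕ NOT PROVED; spine PROVED 0∕9; rung (B)+1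
on a FINITE torus — NOT infinite volume, NOT the mass gap, NOT Clay.  HONEST DEPENDENCY: continuum YM on T⁴ ⇐ BetaPertH ∧ nine spine
estimates (0∕9 proved); BetaPertH ⇐ (D1) ∧ (D4) ∧ CAP+tail; G-an2-4 gates asym, D1 and NE2∕3∕4.
-/

set_option autoImplicit false

noncomputable section

namespace Summit.QuantumFields.BalabanUV.T4Continuum.NE7b.LocalNemytskiiSupBallCovariance

open Set Metric
open scoped ENNReal NNReal
open Summit.QuantumFields.BalabanUV.T4Continuum.NE7b.LocalNemytskiiSup (abs_apply_le_norm)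
open Summit.QuantumFields.BalabanUV.T4Continuum.NE7b.LocalNemytskiiSupBall (exists_smallField_branch_ball)
open Summit.QuantumFields.BalabanUV.T4Continuum.NE7b.SupInteractingChart (fibre_letters norm_symm_inr_le norm_symm_inr_sub_le)

variable {ι : Type*}

/-! ## §1. The Nemytskii modulus on the ball from the displayed action -/

/-- **THE NEMYTSKII DERIVATIVE's MODULUS ON THE SUP BALL**: if `N′φ h i = u′(φ i)·h i` for `‖φ‖ ≤ ρ` and `u′` is `L`-Lipschitz on
`[−ρ, ρ]`, then `‖N′φ − N′ψ‖ ≤ L‖φ − ψ‖` for `‖φ‖, ‖ψ‖ ≤ ρ`. [folklore] -/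
theorem norm_nemytskiiDeriv_sub_le_of_mem
    {N' : lp (fun _ : ι => ℝ) ∞ → (lp (fun _ : ι => ℝ) ∞ →L[ℝ] lp (fun _ : ι => ℝ) ∞)} {u' : ℝ → ℝ} {ρ L : ℝ}
    (hN' : ∀ φ ∈ closedBall (0 : lp (fun _ : ι => ℝ) ∞) ρ, ∀ (h : lp (fun _ : ι => ℝ) ∞) (i : ι), N' φ h i = u' (φ i) * h i)
    (hL0 : 0 ≤ L) (hL : ∀ s t, |s| ≤ ρ → |t| ≤ ρ → |u' s - u' t| ≤ L * |s - t|)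
    {φ ψ : lp (fun _ : ι => ℝ) ∞} (hφ : φ ∈ closedBall (0 : lp (fun _ : ι => ℝ) ∞) ρ)
    (hψ : ψ ∈ closedBall (0 : lp (fun _ : ι => ℝ) ∞) ρ) : ‖N' φ - N' ψ‖ ≤ L * ‖φ - ψ‖ := by
  have hφ' : ‖φ‖ ≤ ρ := by rwa [mem_closedBall, dist_zero_right] at hφ
  have hψ' : ‖ψ‖ ≤ ρ := by rwa [mem_closedBall, dist_zero_right] at hψ
  refine ContinuousLinearMap.opNorm_le_bound _ (mul_nonneg hL0 (norm_nonneg _)) fun h => ?_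
  refine lp.norm_le_of_forall_le (mul_nonneg (mul_nonneg hL0 (norm_nonneg _)) (norm_nonneg _)) fun i => ?_
  rw [Real.norm_eq_abs, sub_apply, lp.coeFn_sub, Pi.sub_apply, hN' φ hφ, hN' ψ hψ, ← sub_mul, abs_mul]
  refine mul_le_mul ((hL _ _ ((abs_apply_le_norm φ i).trans hφ') ((abs_apply_le_norm ψ i).trans hψ')).trans
    (mul_le_mul_of_nonneg_left ?_ hL0)) (abs_apply_le_norm h i) (abs_nonneg _) (mul_nonneg hL0 (norm_nonneg _))
  rw [← Pi.sub_apply, ← lp.coeFn_sub]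
  exact abs_apply_le_norm (φ - ψ) i

/-! ## §2. The fluctuation covariance at the background, local letters -/

section Covariance

variable {F K : Type*} [NormedAddCommGroup F] [NormedSpace ℝ F] [NormedAddCommGroup K] [NormedSpace ℝ K]

/-- **THE FLUCTUATION COVARIANCE AT THE BACKGROUND CONFIGURATION FROM LETTERS ON THE SUP BALL.**  Under
`…LocalNemytskiiSupBall.exists_smallField_branch_ball`'s hypotheses (letters of `u′` on `|t| ≤ ρ` only, `r < ρ`): its conclusions
(Nemytskii map and derivative family on the `ρ`-ball with the modulus there; the branch `σ` with its letters; the interacting chart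
`A(w)`), AND a family `C : F → (K →L ℓ^∞)` such that at every interior `‖w‖ < (N⁻¹ − c)·r`: `Q(C(w)κ) = 0`,
`R(C(w)κ) + P(N′(σ w)(C(w)κ)) = κ` with uniqueness, `‖C(w)κ‖ ≤ (N⁻¹ − c)⁻¹‖κ‖`, `‖C(w)‖ ≤ (N⁻¹ − c)⁻¹`, `C(w) = A(w)⁻¹ ∘ inr`
next to `Dσ(w) = A(w)⁻¹ ∘ inl`, and on the interior ball `‖C(w)κ − C(w′)κ‖ ≤ (N⁻¹ − c)⁻³·(C_P·L)·‖w − w′‖·‖κ‖` — the local-letters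
twin of (61) §8 (its abstract chart letters BY NAME). [folklore] -/
theorem exists_fluctuation_covariance_at_background_ball [Nonempty ι] (Q : lp (fun _ : ι => ℝ) ∞ →L[ℝ] F)
    (R P : lp (fun _ : ι => ℝ) ∞ →L[ℝ] K)
    (T : lp (fun _ : ι => ℝ) ∞ ≃L[ℝ] F × K) (hT : ∀ h, T h = (Q h, R h)) {N c CP lam : ℝ≥0}
    (hN : ∀ y : F × K, ‖T.symm y‖ ≤ N * ‖y‖) (hP : ‖P‖ ≤ CP) (hc : CP * lam ≤ c) (hcN : c < N⁻¹)
    {u u' : ℝ → ℝ} (hu : ∀ t, HasDerivAt u (u' t) t) (hu0 : u 0 = 0) {ρ : ℝ} (hlam : ∀ t, |t| ≤ ρ → |u' t| ≤ lam)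
    {L : ℝ} (hL0 : 0 ≤ L) (hL : ∀ s t, |s| ≤ ρ → |t| ≤ ρ → |u' s - u' t| ≤ L * |s - t|) {r : ℝ} (hr : 0 ≤ r)
    (hrρ : r < ρ) :
    ∃ (Nu : lp (fun _ : ι => ℝ) ∞ → lp (fun _ : ι => ℝ) ∞)
      (N' : lp (fun _ : ι => ℝ) ∞ → (lp (fun _ : ι => ℝ) ∞ →L[ℝ] lp (fun _ : ι => ℝ) ∞)) (σ : F → lp (fun _ : ι => ℝ) ∞)
      (C : F → (K →L[ℝ] lp (fun _ : ι => ℝ) ∞)),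
      (∀ (φ : lp (fun _ : ι => ℝ) ∞) (i : ι), Nu φ i = u (φ i)) ∧
      (∀ φ ∈ closedBall (0 : lp (fun _ : ι => ℝ) ∞) ρ, ∀ (h : lp (fun _ : ι => ℝ) ∞) (i : ι), N' φ h i = u' (φ i) * h i) ∧
      (∀ φ ∈ ball (0 : lp (fun _ : ι => ℝ) ∞) ρ, HasFDerivAt Nu (N' φ) φ) ∧
      (∀ φ ∈ closedBall (0 : lp (fun _ : ι => ℝ) ∞) ρ, ∀ ψ ∈ closedBall (0 : lp (fun _ : ι => ℝ) ∞) ρ,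
        ‖N' φ - N' ψ‖ ≤ L * ‖φ - ψ‖) ∧ σ 0 = 0 ∧
      (∀ w ∈ closedBall (0 : F) (((N : ℝ)⁻¹ - c) * r),
        σ w ∈ closedBall 0 r ∧ Q (σ w) = w ∧ R (σ w) + P (Nu (σ w)) = 0) ∧
      LipschitzOnWith (N⁻¹ - c)⁻¹ σ (closedBall (0 : F) (((N : ℝ)⁻¹ - c) * r)) ∧
      (∀ φ ∈ closedBall (0 : lp (fun _ : ι => ℝ) ∞) r, R φ + P (Nu φ) = 0 → σ (Q φ) = φ) ∧
      (∀ w ∈ ball (0 : F) (((N : ℝ)⁻¹ - c) * r),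
        (∀ κ : K, Q (C w κ) = 0) ∧ (∀ κ : K, R (C w κ) + P (N' (σ w) (C w κ)) = κ) ∧
        (∀ (h : lp (fun _ : ι => ℝ) ∞) (κ : K), Q h = 0 → R h + P (N' (σ w) h) = κ → h = C w κ) ∧
        (∀ κ : K, ‖C w κ‖ ≤ ((N : ℝ)⁻¹ - c)⁻¹ * ‖κ‖) ∧ ‖C w‖ ≤ ((N : ℝ)⁻¹ - c)⁻¹ ∧
        ∃ A : lp (fun _ : ι => ℝ) ∞ ≃L[ℝ] F × K,
          (∀ h, A h = (Q h, R h + P (N' (σ w) h))) ∧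
          (∀ z : F × K, ‖A.symm z‖ ≤ ((N : ℝ)⁻¹ - c)⁻¹ * ‖z‖) ∧
          HasFDerivAt σ ((A.symm : F × K →L[ℝ] lp (fun _ : ι => ℝ) ∞).comp (ContinuousLinearMap.inl ℝ F K)) w ∧
          C w = (A.symm : F × K →L[ℝ] lp (fun _ : ι => ℝ) ∞).comp (ContinuousLinearMap.inr ℝ F K)) ∧
      (∀ w ∈ ball (0 : F) (((N : ℝ)⁻¹ - c) * r), ∀ w' ∈ ball (0 : F) (((N : ℝ)⁻¹ - c) * r), ∀ κ : K,
        ‖C w κ - C w' κ‖ ≤ ((N : ℝ)⁻¹ - c)⁻¹ ^ 3 * (CP * L) * ‖w - w'‖ * ‖κ‖) := by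
  classical
  obtain ⟨Nu, N', σ, hNapp, hN'app, hNderiv, hσ0, hσ, hlip, huniq, -, hchart⟩ :=
    exists_smallField_branch_ball Q R P T hT hN hP hc hcN hu hu0 hlam hL0 hL hr hrρ
  have hmod : ∀ φ ∈ closedBall (0 : lp (fun _ : ι => ℝ) ∞) ρ, ∀ ψ ∈ closedBall (0 : lp (fun _ : ι => ℝ) ∞) ρ,
      ‖N' φ - N' ψ‖ ≤ L * ‖φ - ψ‖ := fun φ hφ ψ hψ => norm_nemytskiiDeriv_sub_le_of_mem hN'app hL0 hL hφ hψ
  choose A hAeq hAinv hAd using hchart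
  have hcN' : (c : ℝ) < (N : ℝ)⁻¹ := by
    have h := NNReal.coe_lt_coe.2 hcN
    rwa [NNReal.coe_inv] at h
  have hK0 : (0 : ℝ) ≤ ((N : ℝ)⁻¹ - c)⁻¹ := inv_nonneg.2 (sub_nonneg.2 hcN'.le)
  have hKcoe : (((N⁻¹ - c)⁻¹ : ℝ≥0) : ℝ) = ((N : ℝ)⁻¹ - c)⁻¹ := by
    rw [NNReal.coe_inv, NNReal.coe_sub hcN.le, NNReal.coe_inv]
  -- backgrounds on the closed chart ball lie in the closed `ρ`-ball (`‖σ w‖ ≤ r < ρ`)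
  have hσρ : ∀ w ∈ ball (0 : F) (((N : ℝ)⁻¹ - c) * r), σ w ∈ closedBall (0 : lp (fun _ : ι => ℝ) ∞) ρ := fun w hw =>
    closedBall_subset_closedBall hrρ.le (hσ w (ball_subset_closedBall hw)).1
  -- the interacting chart's second letter `S(w) = R + P ∘ N′(σ w)`
  have hS : ∀ (w : F) (hw : w ∈ ball (0 : F) (((N : ℝ)⁻¹ - c) * r)) (h : lp (fun _ : ι => ℝ) ∞),
      A w hw h = (Q h, (R + P.comp (N' (σ w))) h) := fun w hw h => by
    rw [hAeq, add_apply, ContinuousLinearMap.comp_apply]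
  -- the covariance family, sealed behind its action on the interior ball
  obtain ⟨C, hC⟩ : ∃ C : F → (K →L[ℝ] lp (fun _ : ι => ℝ) ∞),
      ∀ (w : F) (hw : w ∈ ball (0 : F) (((N : ℝ)⁻¹ - c) * r)),
        C w = ((A w hw).symm : F × K →L[ℝ] lp (fun _ : ι => ℝ) ∞).comp (ContinuousLinearMap.inr ℝ F K) :=
    ⟨fun w => if hw : w ∈ ball (0 : F) (((N : ℝ)⁻¹ - c) * r) then
        ((A w hw).symm : F × K →L[ℝ] lp (fun _ : ι => ℝ) ∞).comp (ContinuousLinearMap.inr ℝ F K) else 0,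
      fun w hw => dif_pos hw⟩
  have hCapp : ∀ (w : F) (hw : w ∈ ball (0 : F) (((N : ℝ)⁻¹ - c) * r)) (κ : K), C w κ = (A w hw).symm (0, κ) :=
    fun w hw κ => by rw [hC w hw]; rfl
  refine ⟨Nu, N', σ, C, hNapp, hN'app, hNderiv, hmod, hσ0, hσ, hlip, huniq, fun w hw => ?_, fun w hw w' hw' κ => ?_⟩
  · obtain ⟨hb, hop⟩ := norm_symm_inr_le (A w hw) hK0 (hAinv w hw)
    refine ⟨fun κ => ?_, fun κ => ?_, fun h κ h1 h2 => ?_, fun κ => ?_, ?_, A w hw, hAeq w hw, hAinv w hw, hAd w hw, hC w hw⟩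
    · rw [hCapp w hw]; exact (fibre_letters (A w hw) Q _ (hS w hw) κ).1
    · have e := (fibre_letters (A w hw) Q _ (hS w hw) κ).2.1
      rw [add_apply, ContinuousLinearMap.comp_apply] at e
      rw [hCapp w hw]; exact e
    · rw [hCapp w hw]
      exact (fibre_letters (A w hw) Q _ (hS w hw) κ).2.2 h h1 (by rw [add_apply, ContinuousLinearMap.comp_apply]; exact h2)
    · rw [hCapp w hw]; exact hb κ
    · rw [hC w hw]; exact hop
  · rw [hCapp w hw, hCapp w' hw']
    have h1 := norm_symm_inr_sub_le (A w hw) (A w' hw') Q (R + P.comp (N' (σ w))) (R + P.comp (N' (σ w')))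
      (hS w hw) (hS w' hw') hK0 (hAinv w hw) (hAinv w' hw') κ
    have h3 : ‖σ w' - σ w‖ ≤ ((N : ℝ)⁻¹ - c)⁻¹ * ‖w - w'‖ := by
      rw [norm_sub_rev, ← hKcoe]
      exact hlip.norm_sub_le (ball_subset_closedBall hw) (ball_subset_closedBall hw')
    have h2 : ‖(R + P.comp (N' (σ w'))) - (R + P.comp (N' (σ w)))‖
        ≤ CP * (L * (((N : ℝ)⁻¹ - c)⁻¹ * ‖w - w'‖)) := by
      rw [add_sub_add_left_eq_sub, ← ContinuousLinearMap.comp_sub]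
      exact (ContinuousLinearMap.opNorm_comp_le _ _).trans
        (mul_le_mul hP ((hmod _ (hσρ w' hw') _ (hσρ w hw)).trans (mul_le_mul_of_nonneg_left h3 hL0)) (norm_nonneg _)
          CP.coe_nonneg)
    refine h1.trans (le_of_le_of_eq (mul_le_mul_of_nonneg_right
      (mul_le_mul_of_nonneg_left h2 (sq_nonneg _)) (norm_nonneg _)) (by ring))

end Covariance

/-! ## §3. Toy -/

/-- Toy: the modulus constant's shape with the local letter — `N = 2`, `c = 1∕5`, `C_P = 2`, `L(ρ) = 3∕2`: `(N⁻¹ − c)⁻³·(C_P·L) =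
`(10∕3)³·3 = 1000∕9`. -/
example : ((2 : ℝ)⁻¹ - 1 / 5)⁻¹ ^ 3 * (2 * (3 / 2)) = 1000 / 9 := by norm_num

end Summit.QuantumFields.BalabanUV.T4Continuum.NE7b.LocalNemytskiiSupBallCovariance

end
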